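import Summits.AtomisticToContinuum.BoseEinsteinCondensation.Theorems.BECInsertionCorrectorStaticResponseBoundFewBodyAssembly
import Summits.AtomisticToContinuum.BoseEinsteinCondensation.Theorems.BECInsertionCorrectorStaticResponseBoundFewBodyComposition
import Summits.AtomisticToContinuum.BoseEinsteinCondensation.Theorems.BECInsertionCorrectorStaticResponseBoundWeakCoupling
import Summits.AtomisticToContinuum.BoseEinsteinCondensation.Theorems.BECInsertionCorrectorStaticResponseBoundGaugedSquare
import Summits.AtomisticToContinuum.BoseEinsteinCondensation.Theorems.BECInsertionCorrectorStaticResponseBoundComplexGsRep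
import Summits.AtomisticToContinuum.BoseEinsteinCondensation.Theorems.BECInsertionCorrectorStaticResponseBoundWeightedGap
import Summits.AtomisticToContinuum.BoseEinsteinCondensation.Theorems.BECInsertionCorrectorStaticResponseBoundModePairing
import Summits.AtomisticToContinuum.BoseEinsteinCondensation.Theorems.BECInsertionCorrectorStaticResponseBoundFewBodyWindow
import Summits.AtomisticToContinuum.BoseEinsteinCondensation.Theorems.BECInsertionCorrectorStaticResponseBoundMaxFormBoundHolds
import Summits.AtomisticToContinuum.BoseEinsteinCondensation.Theorems.BECInsertionCorrectorStaticResponseBoundTruncationCompactness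
import HarnessLib

/-!
# The few-body half of the static response bound, V: the headline theorems of the seat-c2 layer — UNCONDITIONAL
# (line `stable-fraction-square-completion`; item stmt-AtomisticToContinuum-12057 — this file supports, does not close, the item)

Everything below is assembled from LANDED files of the layer (parts I–IV, the five analytic stubs, and the discharged
classical debt `stub_maxFormBound` = `maxFormBound_of_isRepulsiveFiniteRange`):

* `fewBodyBounded` / `fewBody_staticResponse` — for every repulsive finite-range pair potential (hard cores included), every
  `N`, `L > 0` in the few-body regime `N·E₀(v,N,L)·L² ≤ 4π²/5`, every `k ≠ 0`, every `t` and every finite-energy periodic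
  `Ψ`: `E₀ − 10t²N/|p|² ≤ E_v(Ψ) + t⟨∑ⱼcos(p·xⱼ)⟩_Ψ` — the crux's inequality in a non-trivial interacting regime
  (at `L = (N/ρ)^{1/3}` the regime contains every `N ≤ c(v)(ρa³)^{-1/8}`, `stub_fewBodyWindow`).
* `staticResponseBound_of_largeNHalf`, `staticResponseBound_iff_largeNHalf_holds` — the crux `StaticResponseBound` is
  EQUIVALENT to its many-body half `LargeNHalf` (the crux for `N⁸ρa³ > c`, every `c > 0`); the by-name reduction of the
  seat-c2 skeleton has exactly ONE open node, the registered crux-sized stub `stub_largeNHalf`.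
* `staticResponseBound_iff_coreWeak` — and, for every `ε > 0`, to its large-`N`, WEAK-COUPLING content
  (`N⁸ρa³ > c` and `t² ≤ ε²ρa·max(ρa,|p|²)`): the linear-response window of the thermodynamic regime is ALL the crux contains
  beyond theorems of the tree.
-/

noncomputable section

namespace Summit.AtomisticToContinuum.BoseEinsteinCondensation.Cruxes.StaticResponseBound.FewBody

open MeasureTheory Filter UnitAddTorus
open scoped ENNReal NNReal BigOperators Topology InnerProductSpace
open Literature.MathematicalPhysics.QuantumManyBody.BoseGas
open Summit.AtomisticToContinuum.BoseEinsteinCondensation.Theses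
open Summit.AtomisticToContinuum.BoseEinsteinCondensation.Theses.BECInsertionCorrector
open Summit.AtomisticToContinuum.BoseEinsteinCondensation.Theorems.StaticResponseBound.Negative
open Summit.AtomisticToContinuum.BoseEinsteinCondensation.Cruxes.StaticResponseBound.UvThomsonForceWave

/-- **The few-body static response bound, bounded potentials (unconditional).**  For every bounded repulsive finite-range
pair potential `w`, every particle number `N`, every torus side `L > 0` in the few-body regime `N·E₀(w,N,L)·L² ≤ 4π²/5`,
every wave vector `k ≠ 0` (`p = 2πk/L`), every coupling `t ∈ ℝ` and every finite-energy periodic trial state `Ψ`: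
`E₀(w,N,L) − 10 t² N/|p|² ≤ E_w(Ψ) + t ⟨∑ⱼ cos(p·xⱼ)⟩_Ψ`.  Parts I–II fed with the four landed analytic stubs.
[cite: ReedSimonIV1978, §XII.2; Kato1966, VII §4] -/
theorem fewBodyBounded :
    ∀ w : ℝ → ℝ≥0∞, IsRepulsiveFiniteRange w → (∃ M : ℝ≥0∞, M ≠ ⊤ ∧ ∀ r, w r ≤ M) →
      ∀ (N : ℕ) (L : ℝ), 0 < L →
        (N : ℝ) * (periodicGroundStateEnergy w N L).toReal * L ^ 2 ≤ 4 * Real.pi ^ 2 / 5 →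
        ∀ (k : Fin 3 → ℤ), k ≠ 0 → ∀ (t : ℝ) (Ψ : PeriodicTrialState N L), periodicEnergy w Ψ ≠ ⊤ →
          (periodicGroundStateEnergy w N L).toReal - 10 * t ^ 2 * N / psq L k
            ≤ (periodicEnergy w Ψ).toReal + t * cosMean L k Ψ :=
  stub_fewBodyBounded_of_parts stub_gaugedSquare stub_complexGsRep stub_weightedGap stub_modePairing

/-- **The few-body static response bound, every admissible potential (unconditional; hard cores by truncation and the
discharged `MaxFormBound`).**  Same statement for every repulsive finite-range `v`. [cite: ReedSimonIV1978, §XII.2 and Thm. XIII.64] -/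
theorem fewBody_staticResponse :
    ∀ v : ℝ → ℝ≥0∞, IsRepulsiveFiniteRange v → ∀ (N : ℕ) (L : ℝ), 0 < L →
      (N : ℝ) * (periodicGroundStateEnergy v N L).toReal * L ^ 2 ≤ 4 * Real.pi ^ 2 / 5 →
      ∀ (k : Fin 3 → ℤ), k ≠ 0 → ∀ (t : ℝ) (Ψ : PeriodicTrialState N L), periodicEnergy v Ψ ≠ ⊤ →
        (periodicGroundStateEnergy v N L).toReal - 10 * t ^ 2 * N / psq L k
          ≤ (periodicEnergy v Ψ).toReal + t * cosMean L k Ψ :=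
  fun _v hv _N _L hL hE _k hk t Ψ hΨ =>
    fewBody_of_truncation fewBodyBounded (truncationLimit_of_maxFormBound stub_maxFormBound) hv hL hE hk t Ψ hΨ

/-- **`StaticResponseBound ⟸ LargeNHalf` (registered `staticResponseBound_of_largeNHalf`): the crux BY NAME from its
many-body half ALONE** — few-body half, window, truncation and `MaxFormBound` being theorems. [folklore] -/
theorem staticResponseBound_of_largeNHalf :
    (∀ v : ℝ → ℝ≥0∞, IsRepulsiveFiniteRange v → ∀ c : ℝ, 0 < c →
      ∃ ρ₀ : ℝ, 0 < ρ₀ ∧ ∃ C : ℝ, 0 < C ∧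
        ∀ ρ : ℝ, 0 < ρ → ρ < ρ₀ → ∀ N : ℕ,
          c < (N : ℝ) ^ 8 * (ρ * (scatteringLength v).toReal ^ 3) →
          ∀ k : Fin 3 → ℤ, k ≠ 0 → ∀ t : ℝ, ∀ Ψ : PeriodicTrialState N (sideLength ρ N),
            periodicEnergy v Ψ ≠ ⊤ → Ineq v C ρ N k t Ψ) →
    StaticResponseBound :=
  staticResponseBound_of_fewBody fewBodyBounded stub_fewBodyWindow (truncationLimit_of_maxFormBound stub_maxFormBound)

/-- **`StaticResponseBound ⟺ LargeNHalf` (registered `staticResponseBound_iff_largeNHalf_holds`), unconditional:**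
the crux is EXACTLY its thermodynamic (`N⁸ρa³ > c`, every `c > 0`) content. [folklore] -/
theorem staticResponseBound_iff_largeNHalf_holds :
    StaticResponseBound ↔
    (∀ v : ℝ → ℝ≥0∞, IsRepulsiveFiniteRange v → ∀ c : ℝ, 0 < c →
      ∃ ρ₀ : ℝ, 0 < ρ₀ ∧ ∃ C : ℝ, 0 < C ∧
        ∀ ρ : ℝ, 0 < ρ → ρ < ρ₀ → ∀ N : ℕ,
          c < (N : ℝ) ^ 8 * (ρ * (scatteringLength v).toReal ^ 3) →
          ∀ k : Fin 3 → ℤ, k ≠ 0 → ∀ t : ℝ, ∀ Ψ : PeriodicTrialState N (sideLength ρ N),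
            periodicEnergy v Ψ ≠ ⊤ → Ineq v C ρ N k t Ψ) :=
  staticResponseBound_iff_largeNHalf fewBodyBounded stub_fewBodyWindow
    (truncationLimit_of_maxFormBound stub_maxFormBound)

/-- **`StaticResponseBound ⟺ CoreWeak ε` for every `ε > 0` (registered `staticResponseBound_iff_coreWeak`), unconditional:**
the crux is EXACTLY its large-`N`, linear-response-window content (`N⁸ρa³ > c` and `t² ≤ ε²ρa·max(ρa,|p|²)`). [folklore] -/
theorem staticResponseBound_iff_coreWeak :
    ∀ {ε : ℝ}, 0 < ε →
    (StaticResponseBound ↔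
    (∀ v : ℝ → ℝ≥0∞, IsRepulsiveFiniteRange v → ∀ c : ℝ, 0 < c →
      ∃ ρ₀ : ℝ, 0 < ρ₀ ∧ ∃ C : ℝ, 0 < C ∧
        ∀ ρ : ℝ, 0 < ρ → ρ < ρ₀ → ∀ N : ℕ,
          c < (N : ℝ) ^ 8 * (ρ * (scatteringLength v).toReal ^ 3) →
          ∀ k : Fin 3 → ℤ, k ≠ 0 → ∀ t : ℝ,
            t ^ 2 ≤ ε ^ 2 * (ρ * (scatteringLength v).toReal) *
              max (ρ * (scatteringLength v).toReal) (psq (sideLength ρ N) k) →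
            ∀ Ψ : PeriodicTrialState N (sideLength ρ N), periodicEnergy v Ψ ≠ ⊤ → Ineq v C ρ N k t Ψ)) :=
  fun hε => by
    rw [staticResponseBound_iff_largeNHalf_holds]
    exact ⟨coreWeak_of_largeNHalf _,
      largeNHalf_of_coreWeak hε (fun v hv => exists_groundStateEnergy_toReal_le hv)⟩

end Summit.AtomisticToContinuum.BoseEinsteinCondensation.Cruxes.StaticResponseBound.FewBody

end
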